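/-
Copyright (c) 2026 the pub-hodgecm-mathlib formalisation cell (harness21).  Prover seat hodgecm-mathlib-K2E4-p11 (g5), Track B ∕ K2-LIT, h413 =
`stmt-HodgeConjecture-24833`, line `K2_E1_TraceFormulaBeta`, campaign «EIS-RANK-ONE» ∕ R8-LADDER-2, «MS-2» — THE OPERATOR ROAD, PART (O2c) (dealer K2E1-plan (g6) rulings (66)∕(100)):
the high-part operator `K_T := M ∘L K_Z : 𝓗_k(𝔛) →L[ℂ] L²(𝔛, μ)` of the payer ★ `exists_family_of_operator_letters'`, RANK-GENERIC on ★ S-α's binder `hSieg`, modulo ONE letter `hid`.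
-/
import Summits.HodgeConjecture.HodgeConjecture.Theorems.K2E1BLHighCuspOperatorU             -- ★ p859427 (this seat) (O2a): `exists_highCuspOperator` (`K_Z`)
import Summits.HodgeConjecture.HodgeConjecture.Theorems.K2E1BLSiegelTransportOperatorU     -- ★ p859495 (this seat) (O2b): `exists_siegelTransport` (`M`), `ae_comp_section_of_ae`; brings ★ `exists_siegelSection`
import HarnessLib

/-!
# h413 ∕ Track B «K2-LIT», «MS-2» — `K2E1BLHighPartOperatorU` (RANK `N` on the Siegel binder `hSieg`; `N = 2, 3` corollaries): THE HIGH-PART OPERATOR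
# `K_T := M ∘L K_Z : 𝓗_k(𝔛) →L[ℂ] L²(𝔛, μ)`, `K_T u = 0` a.e. on `{w₁ ≤ T}` and `K_T u [g⁻¹] = R(h)ũ(g) − (R(h)ũ)_B(g)` a.e. for `H(g) > T`, modulo the identification letter `hid`

Cell `pub/hodgecm-mathlib`, crux H413 = `stmt-HodgeConjecture-24833`, route `HCCMUnconditional`; dealer K2E1-plan (g6) rulings (66)∕(100) (operator road (O), part (O2c); the letter `hid` is
paid by K2E1-p11 (g2)'s `K2E1BLHighPartIdentificationU`).  THEOREMS ONLY; lane `--kind proof --supports stmt-HodgeConjecture-24833 --as helper` (count-neutral; closes no socket).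
THE MATHEMATICS [BernsteinLapid2019, §4 Claims 4–5 p. 10; MoeglinWaldspurger1995, I.2.13; Garrett2018, §2.3].  ★ (O2a) gives `K_Z : 𝓗_k(𝔛) →L L²(Z_T, μZ)`, `K_Z u = R(h)(ιu − cnstN ιu)`
a.e. on `Z_T`; ★ (O2b) gives the measurable Siegel section `σ` (`σ[g⁻¹] = B(F)·g` for `H(g) > T ≥ 1`) and the transport `M : L²(Z_T, μZ) →L L²(𝔛, μ)`, `M f = 𝟙_{T<w₁}·(f∘σ)` a.e., together
with the pull-back of a.e.-statements on `Z_T` through `σ` (★ `ae_comp_section_of_ae`).  Hence `K_T := M ∘L K_Z` vanishes a.e. below the cut-off, and at a.e. `x = [g⁻¹]` with `H(g) > T`: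
`K_T u(x) = K_Z u(σ x) = K_Z u(B(F)·g) = R(h)(ιu − cnstN ιu)(B(F)·g)`, which the identification letter `hid` — «the smoothing of the cuspidal projection of the lift is the smoothed lift
minus the constant term of the smoothed lift», `= R(h)ũ(g) − (R(h)ũ)_B(g)` with `ũ(g') = u[g'⁻¹]` — turns into the natural high part of the payer ★ `exists_family_of_operator_letters'`.
* **`exists_highPartOperator`** (rank `N`, binder `hSieg`);  `exists_highPartOperator_two ∕ _three` (★ big cell).
HONEST LABEL.  Count-neutral helper; proves no printed statement; LETTERS: `hid` (K2E1-p11's payer), `IotaBound`∕`ShiftBound`∕`hK1` (★ at the CM pairs), the measure letters of record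
`hβ`∕`hμZ`; HC_CM is proved only modulo the 7 printed citations (2 remaining named inputs: hLiu418 = `stmt-HodgeConjecture-24832`, h413 = `stmt-HodgeConjecture-24833`) until rung 0 closes.

## References
* [BernsteinLapid2019] J. Bernstein, E. Lapid, *On the meromorphic continuation of Eisenstein series*, J. AMS 37 (2024), §4 Claims 4–5 (p. 10).
* [MoeglinWaldspurger1995] C. Mœglin, J.-L. Waldspurger, *Spectral decomposition and Eisenstein series* (1995), I.2.13.
* [Garrett2018] P. Garrett, *Modern analysis of automorphic forms by example* (2018), §2.3.
-/

set_option autoImplicit false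
set_option linter.dupNamespace false  -- the mandated namespace repeats the summit's segment (`HodgeConjecture.HodgeConjecture`)

noncomputable section

open MeasureTheory Measure NumberField IsDedekindDomain Set Filter Topology
open scoped ENNReal NNReal
open Literature.MeasureTheory.Group Literature.NumberTheory.Automorphic Literature.NumberTheory.Automorphic.UnitaryGroup AdelicGroupData
open Summit.HodgeConjecture.HodgeConjecture.Cruxes.H413.K2E1BLBorelSpacesU2Defs
open Summit.HodgeConjecture.HodgeConjecture.Cruxes.H413.K2E1BLBorelOperatorsU2Defs
open Summit.HodgeConjecture.HodgeConjecture.Cruxes.H413.K2E1BLSiegelTransportU (borelQuotHeight_le_supHeight_pZX)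
open Summit.HodgeConjecture.HodgeConjecture.Cruxes.H413.K2E1BLSiegelSectionU (exists_siegelSection)
open Summit.HodgeConjecture.HodgeConjecture.Cruxes.H413.K2E1BLSiegelTransportOperatorU (exists_siegelTransport ae_comp_section_of_ae)
open Summit.HodgeConjecture.HodgeConjecture.Cruxes.H413.K2E1BLHighCuspOperatorU (exists_highCuspOperator)

namespace Summit.HodgeConjecture.HodgeConjecture.Cruxes.H413.K2E1BLHighPartOperatorU

variable {F E : Type} [Field F] [NumberField F] [Field E] [NumberField E] [Algebra F E] {c : E ≃ₐ[F] E} {N : ℕ} [NeZero N]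
variable [MeasurableSpace (quasiSplit F E c N).Adelic] [BorelSpace (quasiSplit F E c N).Adelic]

section HighPart

variable (μ : Measure (quasiSplit F E c N).automorphicQuotient) [(quasiSplit F E c N).IsAutomorphicMeasure μ]
  (νG : Measure (quasiSplit F E c N).Adelic) [νG.IsHaarMeasure] [νG.IsInvInvariant]
  {β : (quasiSplit F E c N).Adelic → ℝ≥0∞} (hβ : IsCoveringWeight ↥((arithmeticBorel F E c N).map (quasiSplit F E c N).arithmeticSubgroup.subtype) β)
  {μZ : Measure (borelQuotient F E c N)}
  (hμZ : ∀ f : borelQuotient F E c N → ℝ≥0∞, Measurable f → ∫⁻ z, f z ∂μZ = ∫⁻ g, β g * f (toBorelQuotient F E c N g) ∂νG)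

include hβ hμZ in
/-- **(O2c) THE HIGH-PART OPERATOR `K_T := M ∘L K_Z`.**  On `hSieg`, `T ≥ 1`; letters: the measure letters of record (`μ` automorphic, `νG` Haar, `hβ`, `hμZ`), `hb : IotaBound k a`,
`hs : ShiftBound k a a₀ h`, K2's cusp decay `hK1` (`C, m ≥ 0`) on `Z_{a₀}` with `a₀ ≤ T`, `μZ(Z_T) < ∞`, and the identification letter `hid` (for every `u`, a.e. on `Z_T`:
`R(h)(ιu − cnstN ιu)(B(F)·g) = R(h)ũ(g) − (R(h)ũ)_B(g)`, `ũ(g') = u[g'⁻¹]`, constant term w.r.t. `ν`, `𝓕`).  THEN there is `K : 𝓗_k(𝔛) →L[ℂ] L²(𝔛, μ)` with, for every `u` and `μ`-a.e. `x`: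
`w₁(x) ≤ T → K u(x) = 0`, and `x = [g⁻¹]`, `H(g) > T → K u(x) = (∫ h(y)·u[(g y)⁻¹] dνG) − (R(h)ũ)_B(g)` — the letter `hK` of ★ `exists_family_of_operator_letters'`.
[cite: BernsteinLapid2019, §4 Claims 4–5 (p. 10)] [cite: MoeglinWaldspurger1995, I.2.13] [cite: Garrett2018, §2.3] -/
theorem exists_highPartOperator
    (hSieg : ∀ γ : (quasiSplit F E c N).arithmeticSubgroup, γ ∉ arithmeticBorel F E c N → ∀ g : (quasiSplit F E c N).Adelic,
      1 < borelHeight g → borelHeight ((γ : (quasiSplit F E c N).Adelic) * g) < 1)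
    {T : ℝ≥0} (hT : 1 ≤ T) {k : ℕ} {a a₀ : ℝ≥0} (hb : IotaBound F E c N k a μ μZ) {h : (quasiSplit F E c N).Adelic → ℂ} (hs : ShiftBound F E c N k a a₀ νG μZ h)
    {C m : ℝ} (hC : 0 ≤ C) (hm : 0 ≤ m)
    (hK1 : ∀ f : HNcusp F E c N k a μZ, ∀ᵐ z ∂(weightedTruncMeasure F E c N k a₀ μZ),
      ‖rightConvFun F E c N νG h ((f : HN F E c N k a μZ) : borelQuotient F E c N → ℂ) z‖ ≤ C * ‖f‖ * ((borelQuotHeight F E c N z : ℝ)) ^ (-m))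
    (haT : a₀ ≤ T) [IsFiniteMeasure (weightedTruncMeasure F E c N 0 T μZ)]
    (ν : Measure (adelicUnipotent F E c N)) (𝓕 : Set (adelicUnipotent F E c N))
    (hid : ∀ u : HX F E c N k μ, ∀ᵐ z ∂(weightedTruncMeasure F E c N 0 T μZ), ∀ g : (quasiSplit F E c N).Adelic, toBorelQuotient F E c N g = z →
      rightConvFun F E c N νG h ((iota hb u - cnstN F E c N k a μZ (iota hb u) : HN F E c N k a μZ) : borelQuotient F E c N → ℂ) z =
        (∫ y, h y * (u : (quasiSplit F E c N).automorphicQuotient → ℂ) ((quasiSplit F E c N).toAutomorphicQuotient (g * y)⁻¹) ∂νG) -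
          borelConstantTerm ν 𝓕 (fun x' => ∫ y, h y * (u : (quasiSplit F E c N).automorphicQuotient → ℂ) ((quasiSplit F E c N).toAutomorphicQuotient (x' * y)⁻¹) ∂νG) g) :
    ∃ K : HX F E c N k μ →L[ℂ] Lp ℂ 2 μ, ∀ u : HX F E c N k μ, ∀ᵐ x ∂μ,
      (supHeight F E c N x ≤ T → ((K u : Lp ℂ 2 μ) : (quasiSplit F E c N).automorphicQuotient → ℂ) x = 0) ∧
      ∀ g : (quasiSplit F E c N).Adelic, (quasiSplit F E c N).toAutomorphicQuotient g⁻¹ = x → T < borelHeight g →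
        ((K u : Lp ℂ 2 μ) : (quasiSplit F E c N).automorphicQuotient → ℂ) x =
          (∫ y, h y * (u : (quasiSplit F E c N).automorphicQuotient → ℂ) ((quasiSplit F E c N).toAutomorphicQuotient (g * y)⁻¹) ∂νG) -
            borelConstantTerm ν 𝓕 (fun x' => ∫ y, h y * (u : (quasiSplit F E c N).automorphicQuotient → ℂ) ((quasiSplit F E c N).toAutomorphicQuotient (x' * y)⁻¹) ∂νG) g := by
  obtain ⟨σ, hσm, hσ, -⟩ := exists_siegelSection hSieg hT
  obtain ⟨KZ, hKZ, -⟩ := exists_highCuspOperator hb hs hC hm hK1 haT (lt_of_lt_of_le one_pos hT)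
  obtain ⟨C', M, -, -, hM, -, -⟩ := exists_siegelTransport μ νG hβ hμZ hSieg hT hσm hσ
  refine ⟨M.comp KZ, fun u => ?_⟩
  -- the two a.e. statements on `Z_T`, pulled back through `σ`
  have hQ := ae_comp_section_of_ae μ νG hβ hμZ hSieg hT hσm hσ ((hKZ u).and (hid u))
  filter_upwards [hM (KZ u), hQ] with x hxM hxQ
  refine ⟨fun hle => ?_, fun g hgx hg => ?_⟩
  · rw [ContinuousLinearMap.comp_apply, hxM, Set.indicator_of_notMem (show x ∉ {x | T < supHeight F E c N x} from not_lt.2 hle)]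
  · -- `x = [g⁻¹] = p(B(F)·g)`, so `w₁ x ≥ H(g) > T` and `σ x = B(F)·g`
    have hxT : T < supHeight F E c N x := by
      rw [← hgx, ← pZX_toBorelQuotient]
      exact lt_of_lt_of_le (by rw [borelQuotHeight_toBorelQuotient]; exact hg) (borelQuotHeight_le_supHeight_pZX _)
    have hσx : σ x = toBorelQuotient F E c N g := by rw [← hgx]; exact hσ g hg
    obtain ⟨hq1, hq2⟩ := hxQ hxT
    rw [ContinuousLinearMap.comp_apply, hxM, Set.indicator_of_mem (show x ∈ {x | T < supHeight F E c N x} from hxT)]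
    show ((KZ u : HN F E c N 0 T μZ) : borelQuotient F E c N → ℂ) (σ x) = _
    rw [hq1, hq2 g hσx.symm]

end HighPart

/-! ## `N = 2` and `N = 3`: the Siegel binder discharged (★ big cell) -/

end Summit.HodgeConjecture.HodgeConjecture.Cruxes.H413.K2E1BLHighPartOperatorU

namespace Summit.HodgeConjecture.HodgeConjecture.Cruxes.H413.K2E1BLHighPartOperatorU

variable {F E : Type} [Field F] [NumberField F] [Field E] [NumberField E] [Algebra F E] {c : E ≃ₐ[F] E}

/-- `N = 2`: **the high-part operator `K_T`**, letter-free in `hSieg` (★ `borelHeight_mul_lt_one_of_not_mem_arithmeticBorel_two`); letters as in `exists_highPartOperator`.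
[cite: BernsteinLapid2019, §4 Claims 4–5 (p. 10)] [cite: Garrett2018, §1.5 and §2.3] -/
theorem exists_highPartOperator_two [MeasurableSpace (quasiSplit F E c 2).Adelic] [BorelSpace (quasiSplit F E c 2).Adelic]
    (μ : Measure (quasiSplit F E c 2).automorphicQuotient) [(quasiSplit F E c 2).IsAutomorphicMeasure μ]
    (νG : Measure (quasiSplit F E c 2).Adelic) [νG.IsHaarMeasure] [νG.IsInvInvariant]
    {β : (quasiSplit F E c 2).Adelic → ℝ≥0∞} (hβ : IsCoveringWeight ↥((arithmeticBorel F E c 2).map (quasiSplit F E c 2).arithmeticSubgroup.subtype) β)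
    {μZ : Measure (borelQuotient F E c 2)}
    (hμZ : ∀ f : borelQuotient F E c 2 → ℝ≥0∞, Measurable f → ∫⁻ z, f z ∂μZ = ∫⁻ g, β g * f (toBorelQuotient F E c 2 g) ∂νG)
    {T : ℝ≥0} (hT : 1 ≤ T) {k : ℕ} {a a₀ : ℝ≥0} (hb : IotaBound F E c 2 k a μ μZ) {h : (quasiSplit F E c 2).Adelic → ℂ} (hs : ShiftBound F E c 2 k a a₀ νG μZ h)
    {C m : ℝ} (hC : 0 ≤ C) (hm : 0 ≤ m)
    (hK1 : ∀ f : HNcusp F E c 2 k a μZ, ∀ᵐ z ∂(weightedTruncMeasure F E c 2 k a₀ μZ),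
      ‖rightConvFun F E c 2 νG h ((f : HN F E c 2 k a μZ) : borelQuotient F E c 2 → ℂ) z‖ ≤ C * ‖f‖ * ((borelQuotHeight F E c 2 z : ℝ)) ^ (-m))
    (haT : a₀ ≤ T) [IsFiniteMeasure (weightedTruncMeasure F E c 2 0 T μZ)]
    (ν : Measure (adelicUnipotent F E c 2)) (𝓕 : Set (adelicUnipotent F E c 2))
    (hid : ∀ u : HX F E c 2 k μ, ∀ᵐ z ∂(weightedTruncMeasure F E c 2 0 T μZ), ∀ g : (quasiSplit F E c 2).Adelic, toBorelQuotient F E c 2 g = z →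
      rightConvFun F E c 2 νG h ((iota hb u - cnstN F E c 2 k a μZ (iota hb u) : HN F E c 2 k a μZ) : borelQuotient F E c 2 → ℂ) z =
        (∫ y, h y * (u : (quasiSplit F E c 2).automorphicQuotient → ℂ) ((quasiSplit F E c 2).toAutomorphicQuotient (g * y)⁻¹) ∂νG) -
          borelConstantTerm ν 𝓕 (fun x' => ∫ y, h y * (u : (quasiSplit F E c 2).automorphicQuotient → ℂ) ((quasiSplit F E c 2).toAutomorphicQuotient (x' * y)⁻¹) ∂νG) g) :
    ∃ K : HX F E c 2 k μ →L[ℂ] Lp ℂ 2 μ, ∀ u : HX F E c 2 k μ, ∀ᵐ x ∂μ,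
      (supHeight F E c 2 x ≤ T → ((K u : Lp ℂ 2 μ) : (quasiSplit F E c 2).automorphicQuotient → ℂ) x = 0) ∧
      ∀ g : (quasiSplit F E c 2).Adelic, (quasiSplit F E c 2).toAutomorphicQuotient g⁻¹ = x → T < borelHeight g →
        ((K u : Lp ℂ 2 μ) : (quasiSplit F E c 2).automorphicQuotient → ℂ) x =
          (∫ y, h y * (u : (quasiSplit F E c 2).automorphicQuotient → ℂ) ((quasiSplit F E c 2).toAutomorphicQuotient (g * y)⁻¹) ∂νG) -
            borelConstantTerm ν 𝓕 (fun x' => ∫ y, h y * (u : (quasiSplit F E c 2).automorphicQuotient → ℂ) ((quasiSplit F E c 2).toAutomorphicQuotient (x' * y)⁻¹) ∂νG) g :=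
  exists_highPartOperator μ νG hβ hμZ (fun _ hγ _ hg => borelHeight_mul_lt_one_of_not_mem_arithmeticBorel_two hγ hg) hT hb hs hC hm hK1 haT ν 𝓕 hid

/-- `N = 3`: **the high-part operator `K_T`**, letter-free in `hSieg` (★ `borelHeight_mul_lt_one_of_not_mem_arithmeticBorel`); letters as in `exists_highPartOperator`.
[cite: BernsteinLapid2019, §4 Claims 4–5 (p. 10)] [cite: Rogawski1990, §2.2 p. 13] -/
theorem exists_highPartOperator_three [MeasurableSpace (quasiSplit F E c 3).Adelic] [BorelSpace (quasiSplit F E c 3).Adelic]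
    (μ : Measure (quasiSplit F E c 3).automorphicQuotient) [(quasiSplit F E c 3).IsAutomorphicMeasure μ]
    (νG : Measure (quasiSplit F E c 3).Adelic) [νG.IsHaarMeasure] [νG.IsInvInvariant]
    {β : (quasiSplit F E c 3).Adelic → ℝ≥0∞} (hβ : IsCoveringWeight ↥((arithmeticBorel F E c 3).map (quasiSplit F E c 3).arithmeticSubgroup.subtype) β)
    {μZ : Measure (borelQuotient F E c 3)}
    (hμZ : ∀ f : borelQuotient F E c 3 → ℝ≥0∞, Measurable f → ∫⁻ z, f z ∂μZ = ∫⁻ g, β g * f (toBorelQuotient F E c 3 g) ∂νG)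
    {T : ℝ≥0} (hT : 1 ≤ T) {k : ℕ} {a a₀ : ℝ≥0} (hb : IotaBound F E c 3 k a μ μZ) {h : (quasiSplit F E c 3).Adelic → ℂ} (hs : ShiftBound F E c 3 k a a₀ νG μZ h)
    {C m : ℝ} (hC : 0 ≤ C) (hm : 0 ≤ m)
    (hK1 : ∀ f : HNcusp F E c 3 k a μZ, ∀ᵐ z ∂(weightedTruncMeasure F E c 3 k a₀ μZ),
      ‖rightConvFun F E c 3 νG h ((f : HN F E c 3 k a μZ) : borelQuotient F E c 3 → ℂ) z‖ ≤ C * ‖f‖ * ((borelQuotHeight F E c 3 z : ℝ)) ^ (-m))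
    (haT : a₀ ≤ T) [IsFiniteMeasure (weightedTruncMeasure F E c 3 0 T μZ)]
    (ν : Measure (adelicUnipotent F E c 3)) (𝓕 : Set (adelicUnipotent F E c 3))
    (hid : ∀ u : HX F E c 3 k μ, ∀ᵐ z ∂(weightedTruncMeasure F E c 3 0 T μZ), ∀ g : (quasiSplit F E c 3).Adelic, toBorelQuotient F E c 3 g = z →
      rightConvFun F E c 3 νG h ((iota hb u - cnstN F E c 3 k a μZ (iota hb u) : HN F E c 3 k a μZ) : borelQuotient F E c 3 → ℂ) z =
        (∫ y, h y * (u : (quasiSplit F E c 3).automorphicQuotient → ℂ) ((quasiSplit F E c 3).toAutomorphicQuotient (g * y)⁻¹) ∂νG) -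
          borelConstantTerm ν 𝓕 (fun x' => ∫ y, h y * (u : (quasiSplit F E c 3).automorphicQuotient → ℂ) ((quasiSplit F E c 3).toAutomorphicQuotient (x' * y)⁻¹) ∂νG) g) :
    ∃ K : HX F E c 3 k μ →L[ℂ] Lp ℂ 2 μ, ∀ u : HX F E c 3 k μ, ∀ᵐ x ∂μ,
      (supHeight F E c 3 x ≤ T → ((K u : Lp ℂ 2 μ) : (quasiSplit F E c 3).automorphicQuotient → ℂ) x = 0) ∧
      ∀ g : (quasiSplit F E c 3).Adelic, (quasiSplit F E c 3).toAutomorphicQuotient g⁻¹ = x → T < borelHeight g →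
        ((K u : Lp ℂ 2 μ) : (quasiSplit F E c 3).automorphicQuotient → ℂ) x =
          (∫ y, h y * (u : (quasiSplit F E c 3).automorphicQuotient → ℂ) ((quasiSplit F E c 3).toAutomorphicQuotient (g * y)⁻¹) ∂νG) -
            borelConstantTerm ν 𝓕 (fun x' => ∫ y, h y * (u : (quasiSplit F E c 3).automorphicQuotient → ℂ) ((quasiSplit F E c 3).toAutomorphicQuotient (x' * y)⁻¹) ∂νG) g :=
  exists_highPartOperator μ νG hβ hμZ (fun _ hγ _ hg => borelHeight_mul_lt_one_of_not_mem_arithmeticBorel hγ hg) hT hb hs hC hm hK1 haT ν 𝓕 hid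

end Summit.HodgeConjecture.HodgeConjecture.Cruxes.H413.K2E1BLHighPartOperatorU

end
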